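import Literature.MathematicalPhysics.QuantumLattice.HubbardWave0RepulsiveProofs
import Literature.MathematicalPhysics.QuantumLattice.FermionOperatorsProofs
import HarnessLib

/-!
# Route NoGo — spin algebra behind crux 5 (singlet pairs versus saturated ferromagnets)

Helper file (supports item `stmt-HubbardSuperconductivity-0172`,
`Summit.HubbardSuperconductivity.HubbardSuperconductivity.Theses.NoGo.NogoSingletPairKillsSaturatedFM`),
for the Hubbard orbitals `Orb Λ` of an arbitrary finite lattice `Λ`:

* CAR bookkeeping: `[c†_a c_b, c_p c_q] = δ_{ap} c_q c_b - δ_{aq} c_p c_b`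
  (`hop_pairAnnihilation_commutator`), whence the singlet pair annihilator
  `A_{xy} = c_{x↑} c_{y↓} - c_{x↓} c_{y↑}` commutes with `S⁺`, `S⁻`, `S^z`, hence with
  `S² = (S^z)² + ½(S⁺S⁻ + S⁻S⁺)` (`spinSq_commute_singletPair`: the `SU(2)` selection rule in
  operator form).
* Spin bound (`S ≤ N/2` for `N` spin-½ fermions) as a vanishing lemma: an `n`-particle vector `φ`
  with `S² φ = λ φ` and `λ > (n/2)(n/2+1)` is `0` (`eq_zero_of_isNParticle_of_spinSq_mulVec`). On the
  sector `N↑ = a`, `N↓ = b` (`n = a + b`, `S^z = m = (a-b)/2`) the `su(2)` relations give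
  `‖S⁺ φ‖² = (λ - m² - m) ‖φ‖²` with `λ - m² - m ≥ λ - s(s+1) > 0`, `s = n/2`; induction on `b`
  (`S⁺` maps `(a, b+1) ↦ (a+1, b)` and kills `b = 0`) gives `φ = 0` sector by sector, and an
  `n`-particle vector is the sum of its sector components, each again an `S²`-eigenvector because
  `S²` is block diagonal (`preservesSectors_spinSq`).

Sources: E. H. Lieb, PRL 62 (1989) 1201, eq. (2) and proof of Theorem 1 (spin operators, sectors);
H. Tasaki, *Physics and Mathematics of Quantum Many-Body Systems* (2020) §2.4 (angular momentum
algebra), §9.3 (fermion bilinears); H. Tasaki, Prog. Theor. Phys. 99 (1998) 489, p. 20. All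
statements are folklore consequences of the CAR; the library's `IsSu2Triple` / sector API
(`Su2Multiplet`, `HubbardLiebConfig`, `HubbardWave0LiebProofs`) is reused, nothing is redefined.
-/

namespace Summit.HubbardSuperconductivity.NoGo

open Matrix Finset Literature.MathematicalPhysics.QuantumLattice
open scoped ComplexOrder

noncomputable section

/-! ### CAR bookkeeping: bilinears versus pair annihilators -/

section CAR

variable {ι : Type*} [LinearOrder ι] [Fintype ι]

/-- `[c†_a c_b, c_p c_q] = δ_{ap} c_q c_b - δ_{aq} c_p c_b` (adjoint of `hop_pair_commutator`).
Tasaki (2020) §9.3 (commutators of fermion bilinears). [folklore] -/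
theorem hop_pairAnnihilation_commutator (a b p q : ι) :
    creation a * annihilation b * (annihilation p * annihilation q) -
        annihilation p * annihilation q * (creation a * annihilation b) =
      (if a = p then annihilation q * annihilation b else 0) -
        (if a = q then annihilation p * annihilation b else 0) := by
  have h := congrArg Matrix.conjTranspose (hop_pair_commutator b a q p)
  simp only [conjTranspose_sub, conjTranspose_mul, creation_conjTranspose,
    annihilation_conjTranspose, apply_ite Matrix.conjTranspose, conjTranspose_zero] at h
  calc creation a * annihilation b * (annihilation p * annihilation q) -
        annihilation p * annihilation q * (creation a * annihilation b)
      = -(annihilation p * annihilation q * (creation a * annihilation b) -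
          creation a * annihilation b * (annihilation p * annihilation q)) := by abel
    _ = -((if a = q then annihilation p * annihilation b else 0) -
          (if a = p then annihilation q * annihilation b else 0)) := by rw [h]
    _ = _ := by abel

/-- A `0`-particle vector (a multiple of the vacuum) is annihilated by every `c_i`.
Bratteli–Robinson II §5.2.2. [folklore] -/
theorem annihilation_mulVec_eq_zero_of_isNParticle_zero {ψ : Fock ι} (hψ : IsNParticle 0 ψ)
    (i : ι) : annihilation i *ᵥ ψ = 0 := by
  funext s
  rw [PosSemidefTrace.annihilation_mulVec_apply, Pi.zero_apply]
  by_cases hi : i ∈ s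
  · rw [if_neg (not_not_intro hi)]
  · rw [if_pos hi, hψ _ (by rw [Finset.card_insert_of_notMem hi]; omega), mul_zero]

end CAR

/-! ### The singlet pair annihilator commutes with the spin operators -/

section Singlet

variable {Λ : Type*} [LinearOrder Λ] [Fintype Λ]

/-- `[S⁺, c_{x↑} c_{y↓} - c_{x↓} c_{y↑}] = 0`: termwise
`[c†_{z↑} c_{z↓}, A_{xy}] = δ_{zx} c_{y↓} c_{z↓} + δ_{zy} c_{x↓} c_{z↓}`, and the sum over `z` is the
anticommutator `{c_{y↓}, c_{x↓}} = 0`. Tasaki (2020) §9.3. [folklore] -/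
theorem spinPlus_commute_singletPair (x y : Λ) :
    Commute (spinPlus : Matrix (Finset (Orb Λ)) (Finset (Orb Λ)) ℂ)
      (annihilation (orb x 0) * annihilation (orb y 1) -
        annihilation (orb x 1) * annihilation (orb y 0)) := by
  have h01 : ∀ z w : Λ, orb z 0 ≠ orb w 1 := fun z w h => absurd (orb_eq_orb_iff.1 h).2 (by decide)
  have key : ∀ z : Λ,
      creation (orb z 0) * annihilation (orb z 1) *
            (annihilation (orb x 0) * annihilation (orb y 1) -
              annihilation (orb x 1) * annihilation (orb y 0)) -
          (annihilation (orb x 0) * annihilation (orb y 1) -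
              annihilation (orb x 1) * annihilation (orb y 0)) *
            (creation (orb z 0) * annihilation (orb z 1)) =
        (if z = x then annihilation (orb y 1) * annihilation (orb z 1) else 0) +
          (if z = y then annihilation (orb x 1) * annihilation (orb z 1) else 0) := by
    intro z
    rw [mul_sub, sub_mul, sub_sub_sub_comm, hop_pairAnnihilation_commutator,
      hop_pairAnnihilation_commutator, if_neg (h01 z y), if_neg (h01 z x)]
    by_cases hzx : z = x
    · subst hzx
      by_cases hzy : z = y
      · subst hzy; simp
      · rw [if_pos rfl, if_pos rfl, if_neg (fun h => hzy (orb_eq_orb_iff.1 h).1), if_neg hzy]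
        abel
    · rw [if_neg (fun h => hzx (orb_eq_orb_iff.1 h).1), if_neg hzx]
      by_cases hzy : z = y
      · subst hzy; rw [if_pos rfl, if_pos rfl]; abel
      · rw [if_neg (fun h => hzy (orb_eq_orb_iff.1 h).1), if_neg hzy]; abel
  rw [Commute, SemiconjBy, ← sub_eq_zero, spinPlus, Finset.sum_mul, Finset.mul_sum,
    ← Finset.sum_sub_distrib, Finset.sum_congr rfl fun z _ => key z, Finset.sum_add_distrib,
    Finset.sum_ite_eq', Finset.sum_ite_eq', if_pos (Finset.mem_univ _),
    if_pos (Finset.mem_univ _)]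
  exact annihilation_anticommute_holds _ _

/-- `[S⁻, c_{x↑} c_{y↓} - c_{x↓} c_{y↑}] = 0` (same computation with `↑`, `↓` exchanged).
Tasaki (2020) §9.3. [folklore] -/
theorem spinMinus_commute_singletPair (x y : Λ) :
    Commute (spinMinus : Matrix (Finset (Orb Λ)) (Finset (Orb Λ)) ℂ)
      (annihilation (orb x 0) * annihilation (orb y 1) -
        annihilation (orb x 1) * annihilation (orb y 0)) := by
  have h10 : ∀ z w : Λ, orb z 1 ≠ orb w 0 := fun z w h => absurd (orb_eq_orb_iff.1 h).2 (by decide)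
  have key : ∀ z : Λ,
      creation (orb z 1) * annihilation (orb z 0) *
            (annihilation (orb x 0) * annihilation (orb y 1) -
              annihilation (orb x 1) * annihilation (orb y 0)) -
          (annihilation (orb x 0) * annihilation (orb y 1) -
              annihilation (orb x 1) * annihilation (orb y 0)) *
            (creation (orb z 1) * annihilation (orb z 0)) =
        -(if z = y then annihilation (orb x 0) * annihilation (orb z 0) else 0) -
          (if z = x then annihilation (orb y 0) * annihilation (orb z 0) else 0) := by
    intro z
    rw [mul_sub, sub_mul, sub_sub_sub_comm, hop_pairAnnihilation_commutator,
      hop_pairAnnihilation_commutator, if_neg (h10 z x), if_neg (h10 z y)]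
    by_cases hzx : z = x
    · subst hzx
      by_cases hzy : z = y
      · subst hzy; simp
      · rw [if_pos rfl, if_pos rfl, if_neg (fun h => hzy (orb_eq_orb_iff.1 h).1), if_neg hzy]
        abel
    · rw [if_neg (fun h => hzx (orb_eq_orb_iff.1 h).1), if_neg hzx]
      by_cases hzy : z = y
      · subst hzy; rw [if_pos rfl, if_pos rfl]; abel
      · rw [if_neg (fun h => hzy (orb_eq_orb_iff.1 h).1), if_neg hzy]; abel
  rw [Commute, SemiconjBy, ← sub_eq_zero, spinMinus_eq_sum, Finset.sum_mul, Finset.mul_sum,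
    ← Finset.sum_sub_distrib, Finset.sum_congr rfl fun z _ => key z, Finset.sum_sub_distrib,
    Finset.sum_neg_distrib, Finset.sum_ite_eq', Finset.sum_ite_eq', if_pos (Finset.mem_univ _),
    if_pos (Finset.mem_univ _), neg_sub_left, neg_eq_zero]
  exact annihilation_anticommute_holds _ _

/-- `[Σ_z (n_{z↑} - n_{z↓}), c_{xσ} c_{yτ}] = 0` for opposite spins `σ ≠ τ` (such a pair carries
no `S^z`): termwise `[n_{zρ}, c_p c_q] = δ_{zρ,p} c_q c_{zρ} - δ_{zρ,q} c_p c_{zρ}`, and the sum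
over `z` of the `↑` minus `↓` contributions is `±{c_p, c_q} = 0`. Tasaki (2020) §9.3. [folklore] -/
theorem sum_numberOp_sub_commute_annihilation_pair {σ τ : Fin 2} (hστ : σ ≠ τ) (x y : Λ) :
    Commute (∑ z : Λ, (numberOp z 0 - numberOp z 1) : Matrix (Finset (Orb Λ)) (Finset (Orb Λ)) ℂ)
      (annihilation (orb x σ) * annihilation (orb y τ)) := by
  -- the four Kronecker deltas
  have comm : ∀ (z : Λ) (ρ : Fin 2),
      numberOp z ρ * (annihilation (orb x σ) * annihilation (orb y τ)) -
          annihilation (orb x σ) * annihilation (orb y τ) * numberOp z ρ =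
        (if orb z ρ = orb x σ then annihilation (orb y τ) * annihilation (orb z ρ) else 0) -
          (if orb z ρ = orb y τ then annihilation (orb x σ) * annihilation (orb z ρ) else 0) :=
    fun z ρ => hop_pairAnnihilation_commutator _ _ _ _
  rw [Commute, SemiconjBy, ← sub_eq_zero, Finset.sum_mul, Finset.mul_sum, ← Finset.sum_sub_distrib]
  have key : ∀ z : Λ,
      (numberOp z 0 - numberOp z 1) * (annihilation (orb x σ) * annihilation (orb y τ)) -
          annihilation (orb x σ) * annihilation (orb y τ) * (numberOp z 0 - numberOp z 1) =
        ((if orb z 0 = orb x σ then annihilation (orb y τ) * annihilation (orb z 0) else 0) -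
            (if orb z 1 = orb x σ then annihilation (orb y τ) * annihilation (orb z 1) else 0)) -
          ((if orb z 0 = orb y τ then annihilation (orb x σ) * annihilation (orb z 0) else 0) -
            (if orb z 1 = orb y τ then annihilation (orb x σ) * annihilation (orb z 1) else 0)) := by
    intro z
    rw [sub_mul, mul_sub, sub_sub_sub_comm, comm, comm]
    abel
  rw [Finset.sum_congr rfl fun z _ => key z, Finset.sum_sub_distrib, Finset.sum_sub_distrib,
    Finset.sum_sub_distrib]
  -- evaluate the four sums: exactly one spin index matches in each pair
  have hsum : ∀ (w : Λ) (ρ κ : Fin 2) (f : Λ → Matrix (Finset (Orb Λ)) (Finset (Orb Λ)) ℂ),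
      (∑ z : Λ, if orb z ρ = orb w κ then f z else 0) = if ρ = κ then f w else 0 := by
    intro w ρ κ f
    by_cases hρκ : ρ = κ
    · subst hρκ
      rw [if_pos rfl]
      simp_rw [orb_eq_orb_iff, and_true]
      rw [Finset.sum_ite_eq', if_pos (Finset.mem_univ _)]
    · rw [if_neg hρκ]
      exact Finset.sum_eq_zero fun z _ => if_neg fun h => hρκ (orb_eq_orb_iff.1 h).2
  rw [hsum x 0 σ fun z => annihilation (orb y τ) * annihilation (orb z 0),
    hsum x 1 σ fun z => annihilation (orb y τ) * annihilation (orb z 1),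
    hsum y 0 τ fun z => annihilation (orb x σ) * annihilation (orb z 0),
    hsum y 1 τ fun z => annihilation (orb x σ) * annihilation (orb z 1)]
  have hanti := annihilation_anticommute_holds (ι := Orb Λ) (orb x σ) (orb y τ)
  -- case analysis on the spins
  fin_cases σ <;> fin_cases τ
  · exact absurd rfl hστ
  · simp only [Fin.zero_eta, Fin.isValue, Fin.mk_one, if_true, zero_ne_one, if_false,
      one_ne_zero, sub_zero, zero_sub, sub_neg_eq_add] at hanti ⊢
    rw [add_comm]; exact hanti
  · simp only [Fin.zero_eta, Fin.isValue, Fin.mk_one, if_true, zero_ne_one, if_false,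
      one_ne_zero, sub_zero, zero_sub] at hanti ⊢
    rw [neg_sub_left, neg_eq_zero]; exact hanti
  · exact absurd rfl hστ

/-- `[S^z, c_{xσ} c_{yτ}] = 0` for opposite spins. Tasaki (2020) §9.3. [folklore] -/
theorem spinZ_commute_annihilation_pair {σ τ : Fin 2} (hστ : σ ≠ τ) (x y : Λ) :
    Commute (HubbardWave0.spinZ : Matrix (Finset (Orb Λ)) (Finset (Orb Λ)) ℂ)
      (annihilation (orb x σ) * annihilation (orb y τ)) := by
  rw [HubbardWave0.spinZ]
  exact (sum_numberOp_sub_commute_annihilation_pair hστ x y).smul_left _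

/-- `[S^z, c_{x↑} c_{y↓} - c_{x↓} c_{y↑}] = 0`. Tasaki (2020) §9.3. [folklore] -/
theorem spinZ_commute_singletPair (x y : Λ) :
    Commute (HubbardWave0.spinZ : Matrix (Finset (Orb Λ)) (Finset (Orb Λ)) ℂ)
      (annihilation (orb x 0) * annihilation (orb y 1) -
        annihilation (orb x 1) * annihilation (orb y 0)) :=
  (spinZ_commute_annihilation_pair zero_ne_one x y).sub_right
    (spinZ_commute_annihilation_pair one_ne_zero x y)

/-- **`SU(2)` selection rule, operator form**: the singlet pair annihilator is a scalar under
spin rotations, `[S², c_{x↑} c_{y↓} - c_{x↓} c_{y↑}] = 0`. Tasaki (1998) p. 20; Tasaki (2020)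
§9.3. [folklore] -/
theorem spinSq_commute_singletPair (x y : Λ) :
    Commute (spinSq : Matrix (Finset (Orb Λ)) (Finset (Orb Λ)) ℂ)
      (annihilation (orb x 0) * annihilation (orb y 1) -
        annihilation (orb x 1) * annihilation (orb y 0)) := by
  have hP := spinPlus_commute_singletPair x y
  have hM := spinMinus_commute_singletPair x y
  have hZ := spinZ_commute_singletPair x y
  rw [spinSq]
  exact (hZ.mul_left hZ).add_left (((hP.mul_left hM).add_left (hM.mul_left hP)).smul_left _)

end Singlet

/-! ### The spin bound: `S² ≤ (n/2)(n/2+1)` on `n`-particle vectors, as a vanishing lemma -/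

section SpinBound

variable {Λ : Type*} [LinearOrder Λ] [Fintype Λ]

/-- The product of a spin-raising and a spin-lowering matrix preserves the sectors.
Tasaki (2020) §9.3. [folklore] -/
theorem preservesSectors_raises_mul_lowers {P M : Matrix (Finset (Orb Λ)) (Finset (Orb Λ)) ℂ}
    (hP : RaisesSpin P) (hM : LowersSpin M) : PreservesSectors (P * M) := by
  intro s s'' h
  rw [Matrix.mul_apply] at h
  obtain ⟨s', -, hs'⟩ := Finset.exists_ne_zero_of_sum_ne_zero h
  have h1 := hP s s' (left_ne_zero_of_mul hs')
  have h2 := hM s' s'' (right_ne_zero_of_mul hs')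
  omega

/-- The product of a spin-lowering and a spin-raising matrix preserves the sectors.
Tasaki (2020) §9.3. [folklore] -/
theorem preservesSectors_lowers_mul_raises {P M : Matrix (Finset (Orb Λ)) (Finset (Orb Λ)) ℂ}
    (hM : LowersSpin M) (hP : RaisesSpin P) : PreservesSectors (M * P) := by
  intro s s'' h
  rw [Matrix.mul_apply] at h
  obtain ⟨s', -, hs'⟩ := Finset.exists_ne_zero_of_sum_ne_zero h
  have h1 := hM s s' (left_ne_zero_of_mul hs')
  have h2 := hP s' s'' (right_ne_zero_of_mul hs')
  omega

/-- `S²` is block diagonal with respect to the sectors `(N↑, N↓)`. Lieb, PRL 62 (1989) 1201,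
eq. (2). [folklore] -/
theorem preservesSectors_spinSq :
    PreservesSectors (spinSq : Matrix (Finset (Orb Λ)) (Finset (Orb Λ)) ℂ) := by
  have hZ : PreservesSectors (HubbardWave0.spinZ : Matrix (Finset (Orb Λ)) (Finset (Orb Λ)) ℂ) := by
    rw [LiebThm1.spinZ_eq_diagonal]; exact PreservesSectors.diagonal _
  have hP : RaisesSpin (spinPlus : Matrix (Finset (Orb Λ)) (Finset (Orb Λ)) ℂ) :=
    LiebThm1.raisesSpin_spinPlus
  have hM : LowersSpin (spinPlusᴴ : Matrix (Finset (Orb Λ)) (Finset (Orb Λ)) ℂ) := hP.conjTranspose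
  rw [spinSq]
  exact (hZ.mul hZ).add
    (((preservesSectors_raises_mul_lowers hP hM).add (preservesSectors_lowers_mul_raises hM hP)).smul _)

/-- `S⁻ S⁺ = S² - (S^z)² - S^z`. Tasaki (2020) §2.4, (2.4.9). [folklore] -/
theorem spinMinus_mul_spinPlus_eq :
    (spinMinus * spinPlus : Matrix (Finset (Orb Λ)) (Finset (Orb Λ)) ℂ) =
      spinSq - HubbardWave0.spinZ * HubbardWave0.spinZ - HubbardWave0.spinZ := by
  have h := (LiebTwo.isSu2Triple_spin (Λ := Λ)).su2Casimir_eq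
  rw [LiebTwo.su2Casimir_spin_eq_spinSq] at h
  rw [h]; abel

/-- `‖S⁺ φ‖² = (λ - m² - m) ‖φ‖²` for an `S²`-eigenvector `φ` (eigenvalue `λ`) in the sector
`(a, b)`, `m = (a - b)/2`. Tasaki (2020) §2.4 (norm identity of the raising operator). [folklore] -/
theorem star_spinPlus_mulVec_dotProduct {a b : ℕ} {φ : Fock (Orb Λ)} {lam : ℝ}
    (hφ : IsInSector a b φ) (hS : spinSq *ᵥ φ = (lam : ℂ) • φ) :
    star (spinPlus *ᵥ φ) ⬝ᵥ (spinPlus *ᵥ φ) =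
      ((lam : ℂ) - (1 / 2 * ((a : ℂ) - (b : ℂ))) * (1 / 2 * ((a : ℂ) - (b : ℂ))) -
          1 / 2 * ((a : ℂ) - (b : ℂ))) * (star φ ⬝ᵥ φ) := by
  have hZ := LiebThm1.spinZ_mulVec_of_isInSector hφ
  rw [← LiebThm1.star_dotProduct_conjTranspose_mul_mulVec,
    show ((spinPlus : Matrix (Finset (Orb Λ)) (Finset (Orb Λ)) ℂ)ᴴ) = spinMinus from rfl,
    spinMinus_mul_spinPlus_eq, Matrix.sub_mulVec, Matrix.sub_mulVec, ← Matrix.mulVec_mulVec, hZ,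
    Matrix.mulVec_smul, hZ, hS, smul_smul, ← sub_smul, ← sub_smul, dotProduct_smul, smul_eq_mul]

/-- `s(s+1) - m(m+1) = b (a + 1) ≥ 0` for `s = (a+b)/2`, `m = (a-b)/2`: the weight of a sector never
exceeds its maximal spin. [folklore] -/
theorem weight_bound (a b : ℕ) :
    ((a : ℝ) - b) / 2 * (((a : ℝ) - b) / 2) + ((a : ℝ) - b) / 2 ≤
      ((a : ℝ) + b) / 2 * (((a : ℝ) + b) / 2 + 1) := by
  have ha : (0 : ℝ) ≤ a := Nat.cast_nonneg a
  have hb : (0 : ℝ) ≤ b := Nat.cast_nonneg b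
  nlinarith

/-- **Spin bound, sector form.** A vector of the sector `(a, b)` which is an `S²`-eigenvector with
eigenvalue `λ > s(s+1)`, `s = (a+b)/2`, vanishes (`S ≤ N/2` for `N` spin-`½` fermions). Proof by
induction on `b`: `S⁺` maps `(a, b+1)` to `(a+1, b)` preserving the `S²`-eigenvalue, kills `b = 0`,
and `‖S⁺φ‖² = (λ - m² - m)‖φ‖²` with `λ - m² - m > 0`. Lieb, PRL 62 (1989) 1201 ("`S ≤ N/2`");
Tasaki (2020) §2.4. [folklore] -/
theorem eq_zero_of_isInSector_of_spinSq_mulVec :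
    ∀ (b a : ℕ) (φ : Fock (Orb Λ)) (lam : ℝ), IsInSector a b φ →
      spinSq *ᵥ φ = (lam : ℂ) • φ →
        ((a : ℝ) + b) / 2 * (((a : ℝ) + b) / 2 + 1) < lam → φ = 0 := by
  -- the vanishing step shared by both cases
  have step : ∀ (a b : ℕ) (φ : Fock (Orb Λ)) (lam : ℝ), IsInSector a b φ →
      spinSq *ᵥ φ = (lam : ℂ) • φ → ((a : ℝ) + b) / 2 * (((a : ℝ) + b) / 2 + 1) < lam →
        spinPlus *ᵥ φ = 0 → φ = 0 := by
    intro a b φ lam hφ hS hlt hP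
    have h := star_spinPlus_mulVec_dotProduct hφ hS
    rw [hP, dotProduct_zero] at h
    have hcoef : ((lam : ℂ) - (1 / 2 * ((a : ℂ) - (b : ℂ))) * (1 / 2 * ((a : ℂ) - (b : ℂ))) -
        1 / 2 * ((a : ℂ) - (b : ℂ))) =
        ((lam - (((a : ℝ) - b) / 2 * (((a : ℝ) - b) / 2) + ((a : ℝ) - b) / 2) : ℝ) : ℂ) := by
      push_cast; ring
    have hpos : 0 < lam - (((a : ℝ) - b) / 2 * (((a : ℝ) - b) / 2) + ((a : ℝ) - b) / 2) := by
      have := weight_bound a b; linarith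
    rw [hcoef] at h
    have h0 : star φ ⬝ᵥ φ = 0 :=
      (mul_eq_zero.1 h.symm).resolve_left (by exact_mod_cast hpos.ne')
    exact dotProduct_star_self_eq_zero.1 h0
  intro b
  induction b with
  | zero =>
    intro a φ lam hφ hS hlt
    exact step a 0 φ lam hφ hS hlt (LiebThm1.raisesSpin_spinPlus.mulVec_eq_zero hφ)
  | succ b ih =>
    intro a φ lam hφ hS hlt
    have hφ' : IsInSector (a + 1) b (spinPlus *ᵥ φ) := LiebThm1.raisesSpin_spinPlus.isInSector_mulVec hφ
    have hS' : spinSq *ᵥ (spinPlus *ᵥ φ) = (lam : ℂ) • (spinPlus *ᵥ φ) := by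
      have hc : (spinSq * spinPlus : Matrix (Finset (Orb Λ)) (Finset (Orb Λ)) ℂ) = spinPlus * spinSq := by
        rw [← LiebTwo.su2Casimir_spin_eq_spinSq]; exact LiebTwo.isSu2Triple_spin.su2Casimir_mul_P
      rw [Matrix.mulVec_mulVec, hc, ← Matrix.mulVec_mulVec, hS, Matrix.mulVec_smul]
    have hlt' : ((a + 1 : ℕ) + (b : ℝ)) / 2 * ((((a + 1 : ℕ) : ℝ) + b) / 2 + 1) < lam := by
      push_cast at hlt ⊢; linarith
    exact step a (b + 1) φ lam hφ hS hlt (ih (a + 1) _ lam hφ' hS' hlt')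

/-- **Spin bound, `N`-particle form.** An `n`-particle `S²`-eigenvector with eigenvalue
`λ > (n/2)(n/2 + 1)` vanishes: it is the sum of its sector components `(a, n - a)`, each again an
`S²`-eigenvector since `S²` is block diagonal. Lieb, PRL 62 (1989) 1201; Tasaki (2020) §2.4, §9.3. [folklore] -/
theorem eq_zero_of_isNParticle_of_spinSq_mulVec {n : ℕ} {φ : Fock (Orb Λ)} {lam : ℝ}
    (hφ : IsNParticle n φ) (hS : spinSq *ᵥ φ = (lam : ℂ) • φ)
    (hlt : (n : ℝ) / 2 * ((n : ℝ) / 2 + 1) < lam) : φ = 0 := by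
  rw [← sum_sectorProj_eq hφ]
  refine Finset.sum_eq_zero fun a ha => ?_
  have ha' : a ≤ n := Nat.lt_succ_iff.mp (Finset.mem_range.mp ha)
  refine eq_zero_of_isInSector_of_spinSq_mulVec (n - a) a _ lam (isInSector_sectorProj a (n - a) φ) ?_ ?_
  · rw [preservesSectors_spinSq.mulVec_sectorProj, hS, sectorProj_smul]
  · have hn : ((a : ℝ) + ((n - a : ℕ) : ℝ)) = n := by rw [Nat.cast_sub ha']; ring
    rw [hn]; exact hlt

end SpinBound

end

end Summit.HubbardSuperconductivity.NoGo
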